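import Literature.NumberTheory.LFunctions.FordLogZetaIntegralBound
import HarnessLib

/-!
# Ford's Lemma 3.6, first half: the closed form for the exponent recursion `Δ_n` (`k ≥ 1000`)

Topic `Literature/NumberTheory/LFunctions`. Everything here is PROVED (no named facts).

K. Ford, Proc. LMS 85 (2002), Lemma 3.6 bounds the exponents `Δ_n` of Lemma 3.5 (Wooley-type
iteration of Lemmas 3.2–3.4 with `r_n = ⌊k − Δ_n/k + 1⌋`) for `k ≥ 1000` by
`Δ_n ≤ (3/8) k² e^{1/2 − 2n/k + 1.69/k}` (`2k ≤ n ≤ (k/2)(1/2 + log(3k/8)) + 1`). The proof has two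
parts: the one-step inequality (3.14),
`δ' ≤ δ(1 − ((2−δ)/(2−δ²))(2/k − 32/(21k²) − 16/(7δk³)))` for `δ = Δ_{n-1}/k² > 1/k`,
which is a property of Ford's function `δ₀(k,r,Δ)`; and the passage from (3.14) to the closed form
through the potential `u(y) = y + log y + log(2−y)` ((3.18)–(3.19)). This file proves the SECOND
part in definition-free form, for an arbitrary non-increasing sequence satisfying (3.14):

* `FordL36.u_F_le` — one step of the potential: `u(F_k(δ)) ≤ u(δ) − (β + 0.4β²) + (c/δ)(1 + 0.8β)`
  (`F_k` the right side of (3.14), `β = 2/k − 32/(21k²)`, `c = 16/(7k³)`; `T ≤ −β' − 0.4β'²` via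
  `log(1+x) ≤ x − x²/2 + x³/3` and `((2−δ)²+δ²)/(2(2−δ²)²) ≥ 0.4`);
* `FordL36.F_le_mul_one_sub_alpha` — (3.18): `F_k(δ) ≤ δ(1−α)`, `α = (6/7)(β − kc)`;
* `FordL36.u_chain`, `FordL36.sum_inv_le` — the summed inequality and `∑ 1/δ_i ≤ (1/α)/δ_{n−1}`;
* `FordL36.delta_le_closed_form` — **for `k ≥ 1000`, `δ₁ = (1−1/k)/2`, `δ_{n+1} ≤ δ_n`, and (3.14)
  whenever `δ_n > 1/k`: `δ_n ≤ (3/8)exp(1/2 − 2n/k + 2.03/k)` for `2k ≤ n ≤ (k/2)(1/2+log(3k/8))+1`.**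

On the constant: Ford prints `1.69/k`. Following the printed steps (`c(1+0.8β)∑1/δ_i ≤ 1.34/k`,
`β + 0.4β² ≥ 2/k`, `δ₁(2−δ₁)e^{δ₁} ≤ (3/4)e^{1/2−7/(6k)}`, `(2−δ_n)e^{δ_n} ≥ 2`) one obtains `2.03/k`
(the worst case being `n = 2k`); the printed `1.69` needs refinements that are not displayed (the
true recursion satisfies the bound even with a negative constant). In Theorem 3 this constant only
shifts the range of `k` from which the row `(ρ, θ) = (3.21432, 2.3291)` of (1.7) follows from the
first part of the theorem (`s/k² ≥ 3.213465 + (constant/2)/k` must not exceed `3.21432`: `1.7` gives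
`k ≥ 994`, `2.04` gives `k ≥ 1193`), the computed range of the second part being extended accordingly.

## References

* K. Ford, *Vinogradov's integral and bounds for the Riemann zeta function*, Proc. London Math.
  Soc. (3) 85 (2002), 565–633; arXiv:1910.08209: Lemma 3.6 and its proof, (3.13)–(3.19). [Ford2002]
-/

noncomputable section

open Real Set

namespace Literature.NumberTheory.LFunctions

namespace FordL36

/-! ### The potential `u(x) = x + log x + log(2 − x)` -/

/-- Ford's potential `u(y) = y + log y + log(2 − y)` ("the implicit solution `y + log y + log(2−y) = −βx + C`").
[cite: Ford2002, proof of Lemma 3.6] -/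
def u (x : ℝ) : ℝ := x + Real.log x + Real.log (2 - x)

/-- `u` is non-decreasing on `(0, 1]`. [cite: Ford2002, proof of Lemma 3.6 ("Since y + log y + log(2−y) is increasing on (0,1/2]")] -/
theorem u_mono {x y : ℝ} (hx : 0 < x) (hxy : x ≤ y) (hy : y ≤ 1) : u x ≤ u y := by
  simp only [u]
  have h1 : Real.log x ≤ Real.log y := Real.log_le_log hx hxy
  -- `log(2 − y) − log(2 − x) = log((2−y)/(2−x)) ≥ 1 − (2−x)/(2−y) = −(y−x)/(2−y) ≥ −(y − x)`
  have h2x : 0 < 2 - x := by linarith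
  have h2y : 0 < 2 - y := by linarith
  have h2 : -(y - x) ≤ Real.log (2 - y) - Real.log (2 - x) := by
    rw [← Real.log_div h2y.ne' h2x.ne']
    have := Real.one_sub_inv_le_log_of_pos (show 0 < (2 - y) / (2 - x) by positivity)
    have e : 1 - ((2 - y) / (2 - x))⁻¹ = -(y - x) / (2 - y) := by field_simp; ring
    rw [e] at this
    refine le_trans ?_ this
    rw [le_div_iff₀ h2y]
    nlinarith
  linarith

/-- Auxiliary step (elementary consequence of the definitions and the standing hypotheses). [folklore] -/
theorem exp_u {x : ℝ} (hx : 0 < x) (hx2 : x < 2) : Real.exp (u x) = x * (2 - x) * Real.exp x := by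
  simp only [u]
  rw [Real.exp_add, Real.exp_add, Real.exp_log hx, Real.exp_log (by linarith)]
  ring

/-! ### The constants and the one-step map -/

/-- `β = 2/k − 32/(21k²)`. [cite: Ford2002, proof of Lemma 3.6] -/
def β (k : ℝ) : ℝ := 2 / k - 32 / (21 * k ^ 2)

/-- `c = 16/(7k³)`. [cite: Ford2002, proof of Lemma 3.6] -/
def c (k : ℝ) : ℝ := 16 / (7 * k ^ 3)

/-- `A(δ) = (2 − δ)/(2 − δ²)`. [cite: Ford2002, (3.14)] -/
def A (δ : ℝ) : ℝ := (2 - δ) / (2 - δ ^ 2)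

/-- The right side of (3.14): `F_k(δ) = δ(1 − A(δ)(β − c/δ))`. [cite: Ford2002, (3.14)] -/
def F (k δ : ℝ) : ℝ := δ * (1 - A δ * (β k - c k / δ))

/-- `α = (6/7)(β − kc)`. [cite: Ford2002, (3.18)] -/
def α (k : ℝ) : ℝ := 6 / 7 * (β k - k * c k)

/-- Auxiliary step (elementary consequence of the definitions and the standing hypotheses). [folklore] -/
theorem A_le_one {δ : ℝ} (h0 : 0 ≤ δ) (h1 : δ ≤ 1 / 2) : A δ ≤ 1 := by
  unfold A
  rw [div_le_one (by nlinarith)]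
  nlinarith

/-- Auxiliary step (elementary consequence of the definitions and the standing hypotheses). [folklore] -/
theorem A_ge {δ : ℝ} (h0 : 0 ≤ δ) (h1 : δ ≤ 1 / 2) : 6 / 7 ≤ A δ := by
  unfold A
  rw [le_div_iff₀ (by nlinarith)]
  nlinarith

/-- Auxiliary step (elementary consequence of the definitions and the standing hypotheses). [folklore] -/
theorem beta_sub_kc (k : ℝ) (hk : 0 < k) : β k - k * c k = 2 / k - 80 / (21 * k ^ 2) := by
  unfold β c; field_simp; ring

/-- Auxiliary step (elementary consequence of the definitions and the standing hypotheses). [folklore] -/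
theorem beta_pos {k : ℝ} (hk : 1000 ≤ k) : 0 < β k - k * c k ∧ β k < 2 / k := by
  have hk0 : 0 < k := by linarith
  rw [beta_sub_kc k hk0]
  unfold β
  constructor
  · rw [sub_pos, div_lt_div_iff₀ (by positivity) hk0]; nlinarith
  · have : 0 < 32 / (21 * k ^ 2) := by positivity
    linarith

/-- Auxiliary step (elementary consequence of the definitions and the standing hypotheses). [folklore] -/
theorem alpha_pos {k : ℝ} (hk : 1000 ≤ k) : 0 < α k ∧ α k < 1 := by
  have hk0 : 0 < k := by linarith
  have hb := beta_pos hk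
  have hkc : 0 ≤ k * c k := by unfold c; positivity
  unfold α
  constructor
  · nlinarith
  · have : 2 / k ≤ 2 / 1000 := div_le_div_of_nonneg_left (by norm_num) (by norm_num) hk
    linarith

/-- **(3.18)**: `F_k(δ) ≤ δ(1 − α)` for `1/k < δ ≤ 1/2`. [cite: Ford2002, (3.18)] -/
theorem F_le_mul_one_sub_alpha {k δ : ℝ} (hk : 1000 ≤ k) (hδ0 : 1 / k < δ) (hδ1 : δ ≤ 1 / 2) :
    F k δ ≤ δ * (1 - α k) := by
  have hk0 : 0 < k := by linarith
  have hδpos : 0 < δ := lt_trans (by positivity) hδ0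
  have hb := beta_pos hk
  have hA := A_ge hδpos.le hδ1
  have hc0 : 0 < c k := by unfold c; positivity
  -- `β − c/δ ≥ β − kc`
  have h1 : β k - k * c k ≤ β k - c k / δ := by
    have : c k / δ ≤ k * c k := by
      rw [div_le_iff₀ hδpos]
      have : 1 < k * δ := by rwa [div_lt_iff₀ hk0, mul_comm] at hδ0
      nlinarith
    linarith
  unfold F α
  have h2 : 6 / 7 * (β k - k * c k) ≤ A δ * (β k - c k / δ) :=
    mul_le_mul hA h1 hb.1.le (by linarith)
  nlinarith

/-- `0 < F_k(δ)` for `1/k < δ ≤ 1/2`. [cite: Ford2002, (3.14)] -/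
theorem F_pos {k δ : ℝ} (hk : 1000 ≤ k) (hδ0 : 1 / k < δ) (hδ1 : δ ≤ 1 / 2) : 0 < F k δ := by
  have hk0 : 0 < k := by linarith
  have hδpos : 0 < δ := lt_trans (by positivity) hδ0
  have hb := beta_pos hk
  have hA1 := A_le_one hδpos.le hδ1
  have hA0 : 0 ≤ A δ := le_trans (by norm_num) (A_ge hδpos.le hδ1)
  have hc0 : 0 < c k := by unfold c; positivity
  have h1 : A δ * (β k - c k / δ) < 1 := by
    have hpos : 0 < c k / δ := by positivity
    have h2 : β k - c k / δ < 2 / k := by linarith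
    have h3 : 2 / k ≤ 1 := by rw [div_le_one hk0]; linarith
    rcases le_or_gt 0 (β k - c k / δ) with hs | hs
    · calc A δ * (β k - c k / δ) ≤ 1 * (β k - c k / δ) := mul_le_mul_of_nonneg_right hA1 hs
        _ < 1 := by linarith
    · have : A δ * (β k - c k / δ) ≤ 0 := mul_nonpos_of_nonneg_of_nonpos hA0 hs.le
      linarith
  unfold F
  nlinarith

/-- **The potential drops by `β + 0.4β²` up to the error `c(1 + 0.8β)/δ`**:
`u(F_k(δ)) ≤ u(δ) − (β + 0.4β²) + (c/δ)(1 + 0.8β)` for `1/k < δ ≤ 1/2`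
(`T ≤ −β' − 0.4β'²`, `β' = β − c/δ`, via `log(1+x) ≤ x − x²/2 + x³/3` and
`((2−δ)² + δ²)/(2(2−δ²)²) ≥ 0.4`). [cite: Ford2002, proof of Lemma 3.6 (from (3.14) to (3.19))] -/
theorem u_F_le {k δ : ℝ} (hk : 1000 ≤ k) (hδ0 : 1 / k < δ) (hδ1 : δ ≤ 1 / 2) :
    u (F k δ) ≤ u δ - (β k + 0.4 * β k ^ 2) + c k / δ * (1 + 0.8 * β k) := by
  have hk0 : 0 < k := by linarith
  have hδpos : 0 < δ := lt_trans (by positivity) hδ0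
  have hb := beta_pos hk
  have hc0 : 0 < c k := by unfold c; positivity
  have hd2 : 0 < 2 - δ ^ 2 := by nlinarith
  set b' : ℝ := β k - c k / δ with hb'
  set X : ℝ := A δ * b' with hX
  set Y : ℝ := δ * b' / (2 - δ ^ 2) with hY
  have hA1 := A_le_one hδpos.le hδ1
  have hA0 : 6 / 7 ≤ A δ := A_ge hδpos.le hδ1
  -- `b' ∈ (0, 2/k)`
  have hkc : c k / δ ≤ k * c k := by
    rw [div_le_iff₀ hδpos]
    have : 1 < k * δ := by rwa [div_lt_iff₀ hk0, mul_comm] at hδ0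
    nlinarith
  have hb'0 : 0 < b' := by rw [hb']; linarith [hb.1]
  have hcδ : 0 < c k / δ := by positivity
  have hb'1 : b' < 2 / k := by rw [hb']; linarith [hb.2]
  have hb'2 : b' < 1 / 500 := by
    have : 2 / k ≤ 2 / 1000 := div_le_div_of_nonneg_left (by norm_num) (by norm_num) hk
    linarith
  have hX0 : 0 < X := by rw [hX]; exact mul_pos (by linarith) hb'0
  have hX1 : X < 1 := by
    calc X ≤ 1 * b' := mul_le_mul_of_nonneg_right hA1 hb'0.le
      _ < 1 := by linarith
  have hY0 : 0 < Y := by rw [hY]; positivity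
  -- the three pieces of `u(F) − u(δ)`
  have hF : F k δ = δ * (1 - X) := by simp only [F, hX, hb']
  have hFpos : 0 < F k δ := by rw [hF]; exact mul_pos hδpos (by linarith)
  have e2 : 2 - F k δ = (2 - δ) * (1 + Y) := by
    rw [hF, hY, hX, A]; field_simp; ring
  have hT : u (F k δ) - u δ = -(δ * X) + Real.log (1 - X) + Real.log (1 + Y) := by
    simp only [u]
    rw [e2, Real.log_mul (by linarith) (by linarith), hF, Real.log_mul hδpos.ne' (by linarith)]
    ring
  have hl1 := FordL34.log_one_add_le_cubic (x := -X) (by linarith)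
  have hl2 := FordL34.log_one_add_le_cubic (x := Y) (by linarith)
  have e1 : (1 : ℝ) + -X = 1 - X := by ring
  have e1' : (-X) - (-X) ^ 2 / 2 + (-X) ^ 3 / 3 = -X - X ^ 2 / 2 - X ^ 3 / 3 := by ring
  rw [e1, e1'] at hl1
  -- linear part is exactly `−b'`
  have hlin : -(δ * X) + -X + Y = -b' := by
    rw [hX, hY, A]; field_simp; ring
  -- quadratic part: `X² + Y² ≥ 0.8 b'²`
  have hquad : 0.8 * b' ^ 2 ≤ X ^ 2 + Y ^ 2 := by
    have hpoly : 0.8 * (2 - δ ^ 2) ^ 2 ≤ (2 - δ) ^ 2 + δ ^ 2 := by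
      nlinarith [sq_nonneg (δ - 0.4), mul_nonneg (sq_nonneg δ) (show (0:ℝ) ≤ 1 - 4 * δ ^ 2 by nlinarith)]
    have e : X ^ 2 + Y ^ 2 = b' ^ 2 * (((2 - δ) ^ 2 + δ ^ 2) / (2 - δ ^ 2) ^ 2) := by
      rw [hX, hY, A]; field_simp
    rw [e]
    have hm : 0.8 ≤ ((2 - δ) ^ 2 + δ ^ 2) / (2 - δ ^ 2) ^ 2 := by
      rw [le_div_iff₀ (by positivity)]; exact hpoly
    have := mul_le_mul_of_nonneg_left hm (sq_nonneg b')
    linarith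
  -- cubic part: `Y ≤ X`
  have hcub : Y ≤ X := by
    have e : X - Y = b' * (2 - 2 * δ) / (2 - δ ^ 2) := by
      rw [hX, hY, A]; field_simp; ring
    have : 0 ≤ b' * (2 - 2 * δ) / (2 - δ ^ 2) := div_nonneg (mul_nonneg hb'0.le (by linarith)) hd2.le
    linarith
  have hcub' : Y ^ 3 ≤ X ^ 3 := pow_le_pow_left₀ hY0.le hcub 3
  -- assemble: `T ≤ −b' − 0.4 b'²`
  have hT2 : u (F k δ) - u δ ≤ -b' - 0.4 * b' ^ 2 := by
    rw [hT]; linarith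
  -- `−b' − 0.4 b'² ≤ −β − 0.4β² + (c/δ)(1 + 0.8β)`
  have hlast : -b' - 0.4 * b' ^ 2 ≤ -(β k + 0.4 * β k ^ 2) + c k / δ * (1 + 0.8 * β k) := by
    have e : -b' - 0.4 * b' ^ 2 =
        -(β k + 0.4 * β k ^ 2) + c k / δ * (1 + 0.8 * β k) - 0.4 * (c k / δ) ^ 2 := by
      rw [hb']; ring
    rw [e]
    linarith [sq_nonneg (c k / δ)]
  linarith

/-! ### Numerical facts for `k ≥ 1000` -/

/-- `c(1 + 0.8β)k/α ≤ 1.339/k` for `k ≥ 1000` (Ford: `1.34/k`). [cite: Ford2002, proof of Lemma 3.6] -/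
theorem error_sum_coeff_le {k : ℝ} (hk : 1000 ≤ k) : c k * (1 + 0.8 * β k) * (k / α k) ≤ 1.339 / k := by
  have hk0 : 0 < k := by linarith
  have hα := alpha_pos hk
  have e : c k * (1 + 0.8 * β k) * (k / α k) = (c k * (1 + 0.8 * β k) * k) / α k := by ring
  rw [e, div_le_div_iff₀ hα.1 hk0]
  unfold α
  rw [beta_sub_kc k hk0]
  unfold c β
  rw [← sub_nonneg]
  have e2 : 1.339 * (6 / 7 * (2 / k - 80 / (21 * k ^ 2))) -
      16 / (7 * k ^ 3) * (1 + 0.8 * (2 / k - 32 / (21 * k ^ 2))) * k * k =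
      ((1.339 * 6 * 21 * 2 - 16 * 21) * k ^ 2 - (1.339 * 6 * 80 + 16 * 0.8 * 2 * 21) * k + 16 * 0.8 * 32) / (7 * 21 * k ^ 3) := by
    field_simp; ring
  rw [e2]
  refine div_nonneg ?_ (by positivity)
  nlinarith

/-- `β + 0.4β² ≥ 2/k + 0.07375/k²` for `k ≥ 1000`. [cite: Ford2002, proof of Lemma 3.6 ("β + 0.4β² ≥ 2/k")] -/
theorem beta_add_sq_ge {k : ℝ} (hk : 1000 ≤ k) : 2 / k + 0.07375 / k ^ 2 ≤ β k + 0.4 * β k ^ 2 := by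
  have hk0 : 0 < k := by linarith
  unfold β
  rw [← sub_nonneg]
  have e : 2 / k - 32 / (21 * k ^ 2) + 0.4 * (2 / k - 32 / (21 * k ^ 2)) ^ 2 - (2 / k + 0.07375 / k ^ 2) =
      ((-32 * 21 + 0.4 * 4 * 441 - 0.07375 * 441) * k ^ 2 - 0.4 * 2 * 2 * 32 * 21 * k + 0.4 * 32 ^ 2) / (441 * k ^ 4) := by
    field_simp; ring
  rw [e]
  refine div_nonneg ?_ (by positivity)
  nlinarith

/-- `(2 − x)eˣ ≥ 2` on `[0, 1]`. [folklore] -/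
theorem two_le_two_sub_mul_exp {x : ℝ} (h0 : 0 ≤ x) (h1 : x ≤ 1) : 2 ≤ (2 - x) * Real.exp x := by
  have := Real.add_one_le_exp x
  nlinarith

/-- `δ₁(2 − δ₁)e^{δ₁} ≤ (3/4)e^{1/2 − 7/(6k)}` for `δ₁ = (1 − 1/k)/2`. [cite: Ford2002, proof of Lemma 3.6] -/
theorem delta_one_term_le {k : ℝ} (hk : 1000 ≤ k) :
    (1 - 1 / k) / 2 * (2 - (1 - 1 / k) / 2) * Real.exp ((1 - 1 / k) / 2) ≤ 3 / 4 * Real.exp (1 / 2 - 7 / (6 * k)) := by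
  have hk0 : 0 < k := by linarith
  have h1 : 1 - 1 / k ≤ Real.exp (-(1 / k)) := by have := Real.add_one_le_exp (-(1 / k)); linarith
  have h2 : 1 + 1 / (3 * k) ≤ Real.exp (1 / (3 * k)) := by have := Real.add_one_le_exp (1 / (3 * k)); linarith
  have h1' : 0 ≤ 1 - 1 / k := by rw [sub_nonneg, div_le_one hk0]; linarith
  have e : (1 - 1 / k) / 2 * (2 - (1 - 1 / k) / 2) = 3 / 4 * ((1 - 1 / k) * (1 + 1 / (3 * k))) := by
    field_simp; ring
  rw [e]
  have h3 : (1 - 1 / k) * (1 + 1 / (3 * k)) ≤ Real.exp (-(1 / k)) * Real.exp (1 / (3 * k)) :=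
    mul_le_mul h1 h2 (by positivity) (Real.exp_pos _).le
  have e2 : 3 / 4 * Real.exp (1 / 2 - 7 / (6 * k)) =
      3 / 4 * (Real.exp (-(1 / k)) * Real.exp (1 / (3 * k))) * Real.exp ((1 - 1 / k) / 2) := by
    rw [← Real.exp_add, mul_assoc, ← Real.exp_add]; congr 1; congr 1; field_simp; ring
  rw [e2]
  exact mul_le_mul_of_nonneg_right (mul_le_mul_of_nonneg_left h3 (by norm_num)) (Real.exp_pos _).le

/-! ### The chain -/

section Chain

variable {k : ℝ} (hk : 1000 ≤ k) {d : ℕ → ℝ} (h1 : d 1 = (1 - 1 / k) / 2)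
  (hanti : ∀ n, 1 ≤ n → d (n + 1) ≤ d n)
  (hrec : ∀ n, 1 ≤ n → 1 / k < d n → d (n + 1) ≤ F k (d n))

include hanti in
/-- Monotonicity along the chain. [folklore] -/
theorem d_le_of_le {i n : ℕ} (hi : 1 ≤ i) (hin : i ≤ n) : d n ≤ d i := by
  induction n with
  | zero => omega
  | succ n ih =>
    rcases Nat.eq_or_lt_of_le hin with h | h
    · rw [h]
    · exact (hanti n (by omega)).trans (ih (by omega))

include hk h1 hanti in
/-- `d n ≤ 1/2` for `n ≥ 1`. [folklore] -/
theorem d_le_half {n : ℕ} (hn : 1 ≤ n) : d n ≤ 1 / 2 := by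
  have hk0 : 0 < k := by linarith
  have := d_le_of_le hanti le_rfl hn
  rw [h1] at this
  have : 0 < 1 / k := by positivity
  linarith

include hk h1 hanti hrec in
/-- **The summed potential inequality**: if `d i > 1/k` for `1 ≤ i < n` and `d n > 0`, then
`u(d n) ≤ u(d 1) − (n−1)(β + 0.4β²) + c(1+0.8β) ∑_{1 ≤ i < n} 1/d i`.
[cite: Ford2002, proof of Lemma 3.6 ("Iteration of the above inequality yields …")] -/
theorem u_chain : ∀ n : ℕ, 1 ≤ n → (∀ i, 1 ≤ i → i < n → 1 / k < d i) → 0 < d n →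
    u (d n) ≤ u (d 1) - ((n : ℝ) - 1) * (β k + 0.4 * β k ^ 2) +
      c k * (1 + 0.8 * β k) * ∑ i ∈ Finset.Ico 1 n, 1 / d i := by
  intro n hn
  induction n with
  | zero => omega
  | succ n ih =>
    intro hbig hpos
    rcases Nat.eq_or_lt_of_le hn with h01 | h01
    · -- `n = 0`
      have hn0 : n = 0 := by omega
      subst hn0
      simp
    · have hn1 : 1 ≤ n := by omega
      have hdn : 1 / k < d n := hbig n hn1 (Nat.lt_succ_self n)
      have hk0 : 0 < k := by linarith
      have hdnpos : 0 < d n := lt_trans (by positivity) hdn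
      have hIH := ih hn1 (fun i hi hin ↦ hbig i hi (by omega)) hdnpos
      have hhalf : d n ≤ 1 / 2 := d_le_half hk h1 hanti hn1
      have hstep := u_F_le hk hdn hhalf
      have hF1 : F k (d n) ≤ 1 := by
        have := F_le_mul_one_sub_alpha hk hdn hhalf
        have hα := alpha_pos hk
        nlinarith
      have hmono : u (d (n + 1)) ≤ u (F k (d n)) := u_mono hpos (hrec n hn1 hdn) hF1
      rw [Finset.sum_Ico_succ_top hn1]
      have e : c k * (1 + 0.8 * β k) * (∑ i ∈ Finset.Ico 1 n, 1 / d i + 1 / d n) =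
          c k * (1 + 0.8 * β k) * ∑ i ∈ Finset.Ico 1 n, 1 / d i + c k / d n * (1 + 0.8 * β k) := by ring
      rw [e]
      push_cast
      linarith [hmono, hstep, hIH]

include hk h1 hanti hrec in
/-- **Geometric decay of the reciprocals**: if `d i > 1/k` for `1 ≤ i < n` (`n ≥ 2`), then
`∑_{1 ≤ i < n} 1/d i ≤ (1/α)/d(n−1)`. [cite: Ford2002, proof of Lemma 3.6 ("By (3.13) again, this gives …")] -/
theorem sum_inv_le : ∀ n : ℕ, 2 ≤ n → (∀ i, 1 ≤ i → i < n → 1 / k < d i) →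
    ∑ i ∈ Finset.Ico 1 n, 1 / d i ≤ 1 / α k * (1 / d (n - 1)) := by
  intro n hn
  have hk0 : 0 < k := by linarith
  have hα := alpha_pos hk
  induction n with
  | zero => omega
  | succ n ih =>
    intro hbig
    rcases Nat.eq_or_lt_of_le hn with h2 | h2
    · -- `n + 1 = 2`
      have hn1 : n = 1 := by omega
      subst hn1
      rw [Finset.sum_Ico_succ_top (le_refl 1), Finset.Ico_self, Finset.sum_empty, zero_add,
        Nat.add_one_sub_one]
      have hd1 : 0 < d 1 := lt_trans (by positivity) (hbig 1 le_rfl (by norm_num))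
      have : 1 ≤ 1 / α k := by rw [le_div_iff₀ hα.1]; linarith
      have h0 : 0 < 1 / d 1 := div_pos one_pos hd1
      nlinarith
    · have hn2 : 2 ≤ n := by omega
      have hIH := ih hn2 (fun i hi hin ↦ hbig i hi (by omega))
      have hdn1 : 1 / k < d (n - 1) := hbig (n - 1) (by omega) (by omega)
      have hdn : 1 / k < d n := hbig n (by omega) (Nat.lt_succ_self n)
      have hdn1pos : 0 < d (n - 1) := lt_trans (by positivity) hdn1
      have hdnpos : 0 < d n := lt_trans (by positivity) hdn
      -- `d n ≤ (1 − α) d (n−1)`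
      have hdec : d n ≤ d (n - 1) * (1 - α k) := by
        have e : n = (n - 1) + 1 := by omega
        have h := hrec (n - 1) (by omega) hdn1
        rw [← e] at h
        exact h.trans (F_le_mul_one_sub_alpha hk hdn1 (d_le_half hk h1 hanti (by omega)))
      rw [Finset.sum_Ico_succ_top (by omega), Nat.add_one_sub_one]
      -- `1/d(n−1) ≤ (1−α)/d n`
      have hinv : 1 / d (n - 1) ≤ (1 - α k) / d n := by
        rw [div_le_div_iff₀ hdn1pos hdnpos]; nlinarith
      calc ∑ i ∈ Finset.Ico 1 n, 1 / d i + 1 / d n ≤ 1 / α k * (1 / d (n - 1)) + 1 / d n := by linarith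
        _ ≤ 1 / α k * ((1 - α k) / d n) + 1 / d n := by
            have := mul_le_mul_of_nonneg_left hinv (le_of_lt (div_pos one_pos hα.1)); linarith
        _ = 1 / α k * (1 / d n) := by
            have hα0 : α k ≠ 0 := hα.1.ne'
            have hd0 : d n ≠ 0 := hdnpos.ne'
            field_simp
            ring

set_option maxHeartbeats 400000 in
include hk h1 hanti hrec in
/-- **Ford's Lemma 3.6, the exponent recursion (definition-free form)**: for `k ≥ 1000` and any
non-increasing real sequence `(δ_n)_{n ≥ 1}` with `δ₁ = (1 − 1/k)/2` satisfying the one-step inequality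
(3.14), `δ_{n+1} ≤ δ_n(1 − ((2−δ_n)/(2−δ_n²))(β − c/δ_n))` (`β = 2/k − 32/(21k²)`, `c = 16/(7k³)`)
whenever `δ_n > 1/k` (i.e. (3.13) `Δ_n > k`), one has for `2k ≤ n ≤ (k/2)(1/2 + log(3k/8)) + 1`:
`δ_n ≤ (3/8) exp(1/2 − 2n/k + 2.03/k)` (Ford prints `1.69/k`; `2.03` is what the printed steps give —
`c(1+0.8β)∑1/δ_i ≤ 1.34/k`, `β + 0.4β² ≥ 2/k`, `δ₁(2−δ₁)e^{δ₁} ≤ (3/4)e^{1/2−7/(6k)}` — without the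
unprinted refinements). [cite: Ford2002, Lemma 3.6 (the bound for `Δ_n = k²δ_n`, proof from (3.13) to (3.19))] -/
theorem delta_le_closed_form {n : ℕ} (hn1 : 2 * k ≤ n) (hn2 : (n : ℝ) ≤ k / 2 * (1 / 2 + Real.log (3 * k / 8)) + 1) :
    d n ≤ 3 / 8 * Real.exp (1 / 2 - 2 * n / k + 2.03 / k) := by
  have hk0 : 0 < k := by linarith
  have hn2k : (2 : ℕ) ≤ n := by
    have : (2 : ℝ) ≤ n := le_trans (by linarith) hn1
    exact_mod_cast this
  -- the bound is at least `1/k`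
  have hbound : 1 / k ≤ 3 / 8 * Real.exp (1 / 2 - 2 * n / k + 2.03 / k) := by
    have hlog : Real.exp (-Real.log (3 * k / 8)) = 8 / (3 * k) := by
      rw [Real.exp_neg, Real.exp_log (by positivity)]; field_simp
    have h1 : -Real.log (3 * k / 8) ≤ 1 / 2 - 2 * n / k + 2.03 / k := by
      have : 2 * (n : ℝ) / k ≤ 1 / 2 + Real.log (3 * k / 8) + 2 / k := by
        rw [div_le_iff₀ hk0]
        have := mul_le_mul_of_nonneg_left hn2 (show (0 : ℝ) ≤ 2 by norm_num)
        have e : 2 * (k / 2 * (1 / 2 + Real.log (3 * k / 8)) + 1) =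
            (1 / 2 + Real.log (3 * k / 8) + 2 / k) * k := by field_simp
        linarith
      have : (2 : ℝ) / k ≤ 2.03 / k := div_le_div_of_nonneg_right (by norm_num) hk0.le
      linarith
    have e38 : (1 : ℝ) / k = 3 / 8 * (8 / (3 * k)) := by field_simp
    calc 1 / k = 3 / 8 * (8 / (3 * k)) := e38
      _ = 3 / 8 * Real.exp (-Real.log (3 * k / 8)) := by rw [hlog]
      _ ≤ 3 / 8 * Real.exp (1 / 2 - 2 * n / k + 2.03 / k) :=
          mul_le_mul_of_nonneg_left (Real.exp_le_exp.2 h1) (by norm_num)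
  by_cases hbig : ∀ i, 1 ≤ i → i < n → 1 / k < d i
  · -- case (a): the potential argument
    rcases le_or_gt (d n) 0 with hneg | hpos
    · exact hneg.trans (by positivity)
    have hch := u_chain hk h1 hanti hrec n (by omega) hbig hpos
    have hsum := sum_inv_le hk h1 hanti hrec n hn2k hbig
    have hα := alpha_pos hk
    have hdn1 : 1 / k < d (n - 1) := hbig (n - 1) (by omega) (by omega)
    have hdn1pos : 0 < d (n - 1) := lt_trans (by positivity) hdn1
    -- `∑ 1/d i ≤ k/α`
    have hsum' : ∑ i ∈ Finset.Ico 1 n, 1 / d i ≤ k / α k := by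
      refine hsum.trans ?_
      have : 1 / d (n - 1) ≤ k := by
        rw [div_le_iff₀ hdn1pos]
        rw [div_lt_iff₀ hk0] at hdn1
        nlinarith
      calc 1 / α k * (1 / d (n - 1)) ≤ 1 / α k * k := mul_le_mul_of_nonneg_left this (le_of_lt (div_pos one_pos hα.1))
        _ = k / α k := by ring
    have hc0 : 0 ≤ c k * (1 + 0.8 * β k) := by
      have hb := beta_pos hk
      have h0 : 0 ≤ k * c k := by unfold c; positivity
      have h1' : 0 ≤ c k := by unfold c; positivity
      have h2' : 0 ≤ β k := by linarith
      exact mul_nonneg h1' (by linarith)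
    have herr := error_sum_coeff_le hk
    have hβ2 := beta_add_sq_ge hk
    -- `u(d n) ≤ u(d 1) − (n−1)(2/k + 0.07375/k²) + 1.339/k`
    have hU : u (d n) ≤ u (d 1) - ((n : ℝ) - 1) * (2 / k + 0.07375 / k ^ 2) + 1.339 / k := by
      have hn1' : (1 : ℝ) ≤ (n : ℝ) - 1 := by
        have : (2 : ℝ) ≤ n := by exact_mod_cast hn2k
        linarith
      have e1 := mul_le_mul_of_nonneg_left hβ2 (by linarith : (0 : ℝ) ≤ (n : ℝ) - 1)
      have e2 : c k * (1 + 0.8 * β k) * ∑ i ∈ Finset.Ico 1 n, 1 / d i ≤ 1.339 / k :=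
        (mul_le_mul_of_nonneg_left hsum' hc0).trans herr
      linarith
    -- exponentiate
    have hdn_half : d n ≤ 1 / 2 := d_le_half hk h1 hanti (by omega)
    have hexp := Real.exp_le_exp.2 hU
    have hk1 : 1 / k < 1 := by rw [div_lt_one hk0]; linarith
    have hkp : 0 < 1 / k := by positivity
    have hd1pos : 0 < d 1 := by rw [h1]; linarith
    have hd1lt : d 1 < 2 := by rw [h1]; linarith
    rw [exp_u hpos (by linarith), Real.exp_add, Real.exp_sub, exp_u hd1pos hd1lt] at hexp
    rw [h1] at hexp
    have hδ1 := delta_one_term_le hk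
    have h2 := two_le_two_sub_mul_exp hpos.le (by linarith)
    -- `d n * 2 ≤ d n (2 − d n) e^{d n} ≤ (3/4) e^{1/2 − 7/(6k)} / e^{(n−1)(2/k + 0.07375/k²)} * e^{1.339/k}`
    have hfin : d n * 2 ≤ 3 / 4 * Real.exp (1 / 2 - 7 / (6 * k)) /
        Real.exp (((n : ℝ) - 1) * (2 / k + 0.07375 / k ^ 2)) * Real.exp (1.339 / k) := by
      have hA : d n * 2 ≤ d n * (2 - d n) * Real.exp (d n) := by
        rw [mul_assoc]; exact mul_le_mul_of_nonneg_left h2 hpos.le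
      refine hA.trans (hexp.trans ?_)
      have hpos1 : 0 < Real.exp (((n : ℝ) - 1) * (2 / k + 0.07375 / k ^ 2)) := Real.exp_pos _
      have hpos2 : 0 < Real.exp (1.339 / k) := Real.exp_pos _
      gcongr
    -- compare exponents
    have hcmp : 3 / 4 * Real.exp (1 / 2 - 7 / (6 * k)) /
        Real.exp (((n : ℝ) - 1) * (2 / k + 0.07375 / k ^ 2)) * Real.exp (1.339 / k) ≤
        2 * (3 / 8 * Real.exp (1 / 2 - 2 * n / k + 2.03 / k)) := by
      rw [div_eq_mul_inv, ← Real.exp_neg]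
      have e : 3 / 4 * Real.exp (1 / 2 - 7 / (6 * k)) * Real.exp (-(((n : ℝ) - 1) * (2 / k + 0.07375 / k ^ 2))) *
          Real.exp (1.339 / k) = 2 * (3 / 8 * Real.exp (1 / 2 - 7 / (6 * k) -
            ((n : ℝ) - 1) * (2 / k + 0.07375 / k ^ 2) + 1.339 / k)) := by
        rw [sub_eq_add_neg (1 / 2 - 7 / (6 * k)), Real.exp_add, Real.exp_add]; ring
      rw [e]
      refine mul_le_mul_of_nonneg_left (mul_le_mul_of_nonneg_left (Real.exp_le_exp.2 ?_) (by norm_num)) (by norm_num)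
      -- `−7/(6k) − (n−1)(2/k + 0.07375/k²) + 1.339/k ≤ −2n/k + 2.03/k`
      have hn1r : (2 : ℝ) * k - 1 ≤ (n : ℝ) - 1 := by linarith
      rw [← sub_nonneg]
      have e3 : 1 / 2 - 2 * (n : ℝ) / k + 2.03 / k - (1 / 2 - 7 / (6 * k) - ((n : ℝ) - 1) * (2 / k + 0.07375 / k ^ 2) + 1.339 / k) =
          ((2.03 + 7 / 6 - 1.339 - 2) * k + 0.07375 * ((n : ℝ) - 1)) / k ^ 2 := by
        field_simp; ring
      rw [e3]
      refine div_nonneg ?_ (by positivity)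
      nlinarith
    linarith [hfin, hcmp]
  · -- case (b): some earlier `d i ≤ 1/k`
    push Not at hbig
    obtain ⟨i, hi1, hin, hdi⟩ := hbig
    exact ((d_le_of_le hanti hi1 hin.le).trans hdi).trans hbound

end Chain

end FordL36
end Literature.NumberTheory.LFunctions
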